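/-
Copyright (c) 2026 the pub-hodgecm-mathlib formalisation cell (harness21).  Prover seat hodgecm-mathlib-K2E4-p11 (g5), Track B ∕ K2-LIT, h413 =
`stmt-HodgeConjecture-24833`, line `K2_E1_TraceFormulaBeta`, campaign «EIS-RANK-ONE» ∕ R8-LADDER-2, «MS-2» (σ1)+(σ2) PAIRING SUPPLIER, §1-file = the CONVERGENT-TUBE HALF (dealer
K2E1-plan (g6) DEAL (24) 2026-09-04T09:58:47Z; census 10:01Z): the sesqui-holomorphic pairing `Φ(z,z′) = ⟪Λ^T E(z′), Λ^T E(z)⟫_{L²(X)}` of the truncated spherical Eisenstein series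
of `U(1,1)∕CM` on the tube `{Re z > 1}`, with the four binders `hΦ₁ hΦ₂ hrel hQ` of ★ p858755 `poleControl_continued_cm_two_of_pairing` DISCHARGED there, letter-free.
-/
import Summits.HodgeConjecture.HodgeConjecture.Theorems.K2E1MaassSelbergContinuedCMTwo                 -- ★ p858755: Schwarz reflection `differentiableOn_conj_comp_conj`; the consumer's binders
import Summits.HodgeConjecture.HodgeConjecture.Theorems.K2E1BLHeightPowerHolomorphicU2                 -- ★ `differentiableOn_of_weighted_bound` (dominated pointwise-holomorphic family ⟹ `L²`-holomorphic)
import Summits.HodgeConjecture.HodgeConjecture.Theorems.K2E1TruncatedEisensteinLocallyUniformCMTwo     -- ★ locally uniform bound of `Λ^T E(φ,z)`; ★ `…BoundedCMTwo` (measurability, `L²`), ★ `…RegularU` (holomorphy in `z`)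
import Summits.HodgeConjecture.HodgeConjecture.Theorems.K2E1MaassSelbergPoleControlSphericalCMTwoArch -- ★ `exists_bound_sub_borelConstantTerm_sphericalEisenstein_cm_two` (`hdec′` unconditional)
import Literature.Analysis.Complex.HolomorphicParametricIntegral                                       -- ★ `differentiableOn_integral_of_dominated`
import HarnessLib

/-!
# h413 ∕ Track B «K2-LIT», «MS-2» (σ1)+(σ2) — `K2E1MaassSelbergPairingCMTwo`: the pairing `Φ(z,z′) = ⟪Λ^T E(z′), Λ^T E(z)⟫_{L²(X)}` of the truncated spherical Eisenstein series of
# `U(1,1)∕CM` is holomorphic × antiholomorphic on the tube `{Re > 1}²`, equals the Maass–Selberg four-term `R(z,z′;c)` on the sub-tube, and is `‖Λ^T E(z)‖² ≥ 0` on the diagonal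

Cell `pub/hodgecm-mathlib`, crux H413 = `stmt-HodgeConjecture-24833`, route `HCCMUnconditional`; dealer K2E1-plan (g6) DEAL (24) 09:58:47Z «discharge `hΦ₁ hΦ₂ hrel hQ` of ★
`poleControl_continued_cm_two_of_pairing[_lower]` with `Φ z z′ := ⟪Λ^TẼ(z′), Λ^TẼ(z)⟫`»; census 10:01Z («=»).  THIS FILE = §1, the CONVERGENT-TUBE HALF (typable now, letter-free); §2 (the
continued half on `D± = {Re > ½, Im ≷ 0}`, for the CONTINUED `Ẽ` of the P8 closer) follows the closer.  THEOREMS ONLY (no `def`, no `instance`, no `notation`, no named-fact hypothesis, no `sorry`);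
lane `--kind proof --supports stmt-HodgeConjecture-24833 --as helper` (count-neutral).
THE MATHEMATICS ([MoeglinWaldspurger1995, IV.2.3–IV.3.12]; [Arthur1980TraceFormulaII, §4]; [BernsteinLapid2019, §4 Claim 5]).  Let `F : ℂ ⊃ U → L²(X, μ)` be HOLOMORPHIC (Fréchet, as a map into the
Hilbert space).  Then the pairing `Φ(z,z′) := ⟪F z′, F z⟫` is holomorphic in `z` (a continuous linear functional of `F z`), `w ↦ Φ(z, conj w)` is holomorphic on `conj⁻¹U` (Schwarz
reflection of `z′ ↦ ⟪F z, F z′⟫`), and `Φ(z,z) = ‖F z‖² ≥ 0` (§A — pure Hilbert-space bookkeeping).  For the truncated spherical Eisenstein series `F z := [x ↦ Λ^T E(φ₀H^z)(x)] ∈ L²(X, μ)`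
of `U(1,1)∕CM` on `U = {Re z > 1}`, holomorphy of `F` is ★ `differentiableOn_of_weighted_bound` (a DOMINATED pointwise-holomorphic family is `L²`-holomorphic) fed by: (i) pointwise
holomorphy of `z ↦ Λ^T E(φ₀H^z)(g)` (§B: `Λ^T = 1 − Ψ ∘ c_B^T`; ★ holomorphy of `z ↦ E(φ₀H^z)(g)`; the cut-off pseudo-Eisenstein sum has `z`-FREE subsingleton support for `T ≥ 1`, and each
constant term `E_B(z)(h) = (ν𝓕)⁻¹∫_𝓕 E(z)(uh)dν` is holomorphic by dominated differentiation over the relatively compact `𝓕`, ★ `differentiableOn_integral_of_dominated` with ★ joint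
continuity of `(z,g) ↦ E(z)(g)`), (ii) the locally uniform sup bound ★ `exists_nhds_norm_truncation_eisensteinSeriesU_flatSectionU_le_cm_two` with the decay ★
`exists_bound_sub_borelConstantTerm_sphericalEisenstein_cm_two` (UNCONDITIONAL at `N = 2`), (iii) measurability ★ `measurable_truncation_…_cm_two′` (§C).  Finally (§D) on the tube
`hΦ₁ hΦ₂ hQ` are §A, and `hrel` on the sub-tube `1 < Re z′ < Re z` is ★ (R6k)₂ `maassSelberg_flatSectionU_cm_two_final_spherical` with its survivor `hdec′` paid by ★ (ii) — the
`L²` inner product `⟪F z′, F z⟫ = ∫ conj(F z′)·F z` being the (R6k)₂ left side `∫ quotFun(Λ^TE(z))·conj quotFun(Λ^TE(z′)) dμ`.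
* §A `pairing_of_differentiableOn` (generic Hilbert lemma: `hΦ₁`, `hΦ₂`, `hQ` for `Φ z z′ := ⟪F z′, F z⟫`).
* §B `differentiableOn_borelConstantTerm_eisensteinSeriesU_flatSectionU_cm_two`, `differentiableOn_truncation_eisensteinSeriesU_flatSectionU_apply_cm_two` (pointwise holomorphy in `z`).
* §C **`exists_toLp_truncation_differentiableOn_cm_two`** — the `L²(X, μ)`-valued truncated spherical Eisenstein family is HOLOMORPHIC on `{Re z > 1}`.
* §D HEAD **`pairing_tube_cm_two`** — `∃ F`, representing `Λ^T E(φ₀H^z)` in `L²`, with `hΦ₁ hΦ₂ hQ` on `{Re > 1}` and `hrel` on the sub-tube for `Φ z z′ := ⟪F z′, F z⟫`, letter-free.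
HONEST LABEL.  Count-neutral helper; proves no printed statement; the tube half only (the continued half needs the closer's pole ledger on `D±` and `L²` bounds of `Λ^TẼ`); HC_CM is proved
only modulo the 7 printed citations (2 remaining named inputs: hLiu418 = `stmt-HodgeConjecture-24832`, h413 = `stmt-HodgeConjecture-24833`) until rung 0 closes.

## References
* [MoeglinWaldspurger1995] C. Mœglin, J.-L. Waldspurger, *Spectral decomposition and Eisenstein series* (1995), IV.2.3 (Maass–Selberg), IV.3.12 (continuation argument).
* [Arthur1980TraceFormulaII] J. Arthur, *A trace formula for reductive groups II*, Compositio Math. 40 (1980), §4.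
* [BernsteinLapid2019] J. Bernstein, E. Lapid, *On the meromorphic continuation of Eisenstein series*, J. AMS 37 (2024), §4 (Claim 5: holomorphic families in `L²`).
* [Rudin1991] W. Rudin, *Functional Analysis* (1991), Thm. 3.31 (vector-valued holomorphy).
-/

set_option autoImplicit false
set_option linter.dupNamespace false  -- the mandated namespace repeats the summit's segment (`HodgeConjecture.HodgeConjecture`)

noncomputable section

open MeasureTheory Measure NumberField IsDedekindDomain Set Filter Topology Metric MulAction
open scoped ENNReal NNReal ComplexConjugate InnerProductSpace
open Literature.NumberTheory.Automorphic Literature.NumberTheory.Automorphic.UnitaryGroup AdelicGroupData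
open Literature.Analysis.Complex (differentiableOn_integral_of_dominated)
open Summit.HodgeConjecture.HodgeConjecture.Cruxes.H413.K2E1BorelEisensteinU
open Summit.HodgeConjecture.HodgeConjecture.Cruxes.H413.K2E1BorelEisensteinRegularU
open Summit.HodgeConjecture.HodgeConjecture.Cruxes.H413.K2E1TruncatedEisensteinExplicit
open Summit.HodgeConjecture.HodgeConjecture.Cruxes.H413.K2E1TruncatedEisensteinBoundedCMTwo
open Summit.HodgeConjecture.HodgeConjecture.Cruxes.H413.K2E1TruncatedEisensteinLocallyUniformCMTwo
open Summit.HodgeConjecture.HodgeConjecture.Cruxes.H413.K2E1BLHeightPowerHolomorphicU2 (differentiableOn_of_weighted_bound)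
open Summit.HodgeConjecture.HodgeConjecture.Cruxes.H413.K2E1MaassSelbergContinuedCMTwo (differentiableOn_conj_comp_conj)
open Summit.HodgeConjecture.HodgeConjecture.Cruxes.H413.K2E1MaassSelbergPoleControlSphericalCMTwoArch (exists_bound_sub_borelConstantTerm_sphericalEisenstein_cm_two)

namespace Summit.HodgeConjecture.HodgeConjecture.Cruxes.H413.K2E1MaassSelbergPairingCMTwo

/-! ## §A The pairing of a holomorphic Hilbert-space-valued family -/

section Hilbert

variable {H : Type*} [NormedAddCommGroup H] [InnerProductSpace ℂ H]

/-- **THE PAIRING OF A HOLOMORPHIC FAMILY.**  `F : ℂ → H` holomorphic on the open `U` (as a map into the complex Hilbert space `H`); `Φ z z′ := ⟪F z′, F z⟫`.  Then (`hΦ₁`) `z ↦ Φ z z′` is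
holomorphic on `U` for `z′ ∈ U` (`⟪v, ·⟫` is a continuous linear functional); (`hΦ₂`) `w ↦ Φ z (conj w) = conj ⟪F z, F (conj w)⟫` is holomorphic on `{w | conj w ∈ U}` for `z ∈ U` (Schwarz
reflection ★ `differentiableOn_conj_comp_conj`); (`hQ`) `Φ z z = ‖F z‖² ≥ 0`. [cite: Rudin1991, Thm. 3.31] [cite: MoeglinWaldspurger1995, IV.3.12] -/
theorem pairing_of_differentiableOn {F : ℂ → H} {U : Set ℂ} (hU : IsOpen U) (hF : DifferentiableOn ℂ F U) :
    (∀ z' ∈ U, DifferentiableOn ℂ (fun z : ℂ => ⟪F z', F z⟫_ℂ) U) ∧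
    (∀ z ∈ U, DifferentiableOn ℂ (fun w : ℂ => ⟪F (conj w), F z⟫_ℂ) {w : ℂ | conj w ∈ U}) ∧
    (∀ z ∈ U, 0 ≤ ‖F z‖ ^ 2 ∧ ⟪F z, F z⟫_ℂ = (((‖F z‖ ^ 2 : ℝ)) : ℂ)) := by
  refine ⟨fun z' _ => ((innerSL ℂ (F z')).differentiable.comp_differentiableOn hF), fun z hz => ?_, fun z _ => ⟨sq_nonneg _, ?_⟩⟩
  · have h := differentiableOn_conj_comp_conj hU ((innerSL ℂ (F z)).differentiable.comp_differentiableOn hF)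
    refine h.congr fun w _ => ?_
    show ⟪F (conj w), F z⟫_ℂ = conj ⟪F z, F (conj w)⟫_ℂ
    exact (inner_conj_symm _ _).symm
  · rw [inner_self_eq_norm_sq_to_K]
    push_cast
    rfl

end Hilbert

/-! ## §B Pointwise holomorphy in `z` of the constant term and of the truncation of `E(φ₀H^z)` on `U(1,1)∕CM` -/

section Pointwise

variable (L : Type) [Field L] [NumberField L] [IsCMField L]
variable [MeasurableSpace (adelicUnipotent (↥(maximalRealSubfield L)) L (IsCMField.complexConj L) 2)] [BorelSpace (adelicUnipotent (↥(maximalRealSubfield L)) L (IsCMField.complexConj L) 2)]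

/-- **`z ↦ E(φ, z)_B(h)` IS HOLOMORPHIC on `{Re z > 1}`** for every bounded continuous `φ` and every `h`: `E_B(h) = (ν𝓕)⁻¹ ∫_𝓕 E(z)(u h) dν(u)` over the relatively compact fundamental
domain `𝓕` (★ `borelConstantTerm_def`), differentiated under the integral sign (★ `differentiableOn_integral_of_dominated`) with the pointwise holomorphy ★
`differentiableOn_eisensteinSeriesU_flatSectionU_cm_two` and a constant majorant from the JOINT continuity ★ `continuous_eisensteinSeriesU_flatSectionU_uncurry_cm_two` on the compact
`closedBall z₀ r × (closure 𝓕)·h`. [cite: MoeglinWaldspurger1995, II.1.5–II.1.7] -/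
theorem differentiableOn_borelConstantTerm_eisensteinSeriesU_flatSectionU_cm_two
    (ν : Measure (adelicUnipotent (↥(maximalRealSubfield L)) L (IsCMField.complexConj L) 2)) [ν.IsHaarMeasure]
    {𝓕 : Set (adelicUnipotent (↥(maximalRealSubfield L)) L (IsCMField.complexConj L) 2)} (h𝓕m : NullMeasurableSet 𝓕 ν) (h𝓕c : IsCompact (closure 𝓕))
    {φ : (quasiSplit (↥(maximalRealSubfield L)) L (IsCMField.complexConj L) 2).Adelic → ℂ} (hφc : Continuous φ) {M : ℝ} (hφM : ∀ x, ‖φ x‖ ≤ M)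
    (h : (quasiSplit (↥(maximalRealSubfield L)) L (IsCMField.complexConj L) 2).Adelic) :
    DifferentiableOn ℂ (fun z : ℂ => borelConstantTerm ν 𝓕 (eisensteinSeriesU (flatSectionU φ z)) h) {z : ℂ | 1 < z.re} := by
  -- the parametric integral `z ↦ ∫_{u ∈ 𝓕} E(φ,z)(u h) dν`
  have hint : DifferentiableOn ℂ (fun z : ℂ => ∫ u in 𝓕, eisensteinSeriesU (flatSectionU φ z) ((u : (quasiSplit (↥(maximalRealSubfield L)) L (IsCMField.complexConj L) 2).Adelic) * h) ∂ν) {z : ℂ | 1 < z.re} := by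
    haveI : IsFiniteMeasure (ν.restrict 𝓕) := isFiniteMeasure_restrict.2 ((measure_mono subset_closure).trans_lt h𝓕c.measure_lt_top).ne
    refine differentiableOn_integral_of_dominated (μ := ν.restrict 𝓕) (fun z hz => ?_) (Eventually.of_forall fun u => ?_) fun z₀ hz₀ => ?_
    · exact ((continuous_eisensteinSeriesU_flatSectionU_cm_two L hz hφc hφM).comp (continuous_subtype_val.mul continuous_const)).aestronglyMeasurable
    · exact differentiableOn_eisensteinSeriesU_flatSectionU_cm_two L hφM _
    · -- a constant majorant on the ball `ball z₀ r`, `r = (Re z₀ − 1)∕2`, from joint continuity on the compact `closedBall z₀ r × (closure 𝓕)·h`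
      have hz₀' : 1 < z₀.re := hz₀
      set r : ℝ := (z₀.re - 1) / 2 with hr
      have hr0 : 0 < r := by rw [hr]; linarith
      have hballU : closedBall z₀ r ⊆ {z : ℂ | 1 < z.re} := fun z hz => by
        have h1 : |(z - z₀).re| ≤ r := (Complex.abs_re_le_norm (z - z₀)).trans (by rwa [mem_closedBall, dist_eq_norm] at hz)
        rw [Complex.sub_re] at h1
        show 1 < z.re
        rw [hr] at h1
        linarith [(abs_le.1 h1).1]
      have hKz : IsCompact (Subtype.val ⁻¹' closedBall z₀ r : Set {z : ℂ // (1 : ℝ) < z.re}) :=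
        Topology.IsEmbedding.subtypeVal.isCompact_iff.2 (by
          rw [Set.image_preimage_eq_inter_range, Subtype.range_coe_subtype, Set.inter_eq_left.2 (fun z hz => hballU hz)]
          exact isCompact_closedBall z₀ r)
      have hK : IsCompact ((Subtype.val ⁻¹' closedBall z₀ r : Set {z : ℂ // (1 : ℝ) < z.re}) ×ˢ
          ((fun u : ↥(adelicUnipotent (↥(maximalRealSubfield L)) L (IsCMField.complexConj L) 2) => (u : (quasiSplit (↥(maximalRealSubfield L)) L (IsCMField.complexConj L) 2).Adelic) * h) '' closure 𝓕)) :=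
        hKz.prod (h𝓕c.image (continuous_subtype_val.mul continuous_const))
      obtain ⟨C, hC⟩ := hK.exists_bound_of_continuousOn ((continuous_eisensteinSeriesU_flatSectionU_uncurry_cm_two L hφc hφM).continuousOn)
      refine ⟨r, hr0, ball_subset_closedBall.trans hballU, fun _ => C, integrable_const C, (ae_restrict_iff'₀ h𝓕m).2 (Eventually.of_forall fun u hu z hz => ?_)⟩
      have hz1 : (1 : ℝ) < z.re := hballU (ball_subset_closedBall hz)
      exact hC ⟨⟨z, hz1⟩, (u : (quasiSplit (↥(maximalRealSubfield L)) L (IsCMField.complexConj L) 2).Adelic) * h⟩ ⟨show (z : ℂ) ∈ closedBall z₀ r from ball_subset_closedBall hz, Set.mem_image_of_mem _ (subset_closure hu)⟩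
  have hfun : (fun z : ℂ => borelConstantTerm ν 𝓕 (eisensteinSeriesU (flatSectionU φ z)) h) =
      fun z : ℂ => ((ν 𝓕).toReal⁻¹ : ℝ) • ∫ u in 𝓕, eisensteinSeriesU (flatSectionU φ z) ((u : (quasiSplit (↥(maximalRealSubfield L)) L (IsCMField.complexConj L) 2).Adelic) * h) ∂ν :=
    funext fun z => borelConstantTerm_def ν 𝓕 _ h
  rw [hfun]
  exact hint.const_smul ((ν 𝓕).toReal⁻¹ : ℝ)

/-- **`z ↦ Λ^T E(φ, z)(g)` IS HOLOMORPHIC on `{Re z > 1}`** for `T ≥ 1`, every bounded continuous `φ` and every `g`: `Λ^T E = E − Ψ(c_B^T E)` (★ `truncation_def`), where for `T ≥ 1` the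
cut-off pseudo-Eisenstein sum `Ψ(c_B^T E(z))(g) = ∑_{δ : H(δg) > T} E(z)_B(δg)` runs over a `z`-FREE subsingleton set of cosets (★ `subsingleton_setOf_lt_borelHeight_out_mul` with ★ `siegel_two`),
each term holomorphic by `differentiableOn_borelConstantTerm_eisensteinSeriesU_flatSectionU_cm_two`. [cite: MoeglinWaldspurger1995, I.2.13, II.1.5] [cite: Garrett2018, §2.10] -/
theorem differentiableOn_truncation_eisensteinSeriesU_flatSectionU_apply_cm_two
    (ν : Measure (adelicUnipotent (↥(maximalRealSubfield L)) L (IsCMField.complexConj L) 2)) [ν.IsHaarMeasure]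
    {𝓕 : Set (adelicUnipotent (↥(maximalRealSubfield L)) L (IsCMField.complexConj L) 2)} (h𝓕m : NullMeasurableSet 𝓕 ν) (h𝓕c : IsCompact (closure 𝓕))
    {T : ℝ≥0} (hT : 1 ≤ T) {φ : (quasiSplit (↥(maximalRealSubfield L)) L (IsCMField.complexConj L) 2).Adelic → ℂ} (hφc : Continuous φ) {M : ℝ} (hφM : ∀ x, ‖φ x‖ ≤ M)
    (g : (quasiSplit (↥(maximalRealSubfield L)) L (IsCMField.complexConj L) 2).Adelic) :
    DifferentiableOn ℂ (fun z : ℂ => truncation ν 𝓕 T (eisensteinSeriesU (flatSectionU φ z)) g) {z : ℂ | 1 < z.re} := by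
  -- the `z`-free finite set of high cosets
  have hfin : ({q : Quotient (QuotientGroup.rightRel (arithmeticBorel (↥(maximalRealSubfield L)) L (IsCMField.complexConj L) 2)) |
      T < borelHeight (((q.out : (quasiSplit (↥(maximalRealSubfield L)) L (IsCMField.complexConj L) 2).arithmeticSubgroup) : (quasiSplit (↥(maximalRealSubfield L)) L (IsCMField.complexConj L) 2).Adelic) * g)}).Finite :=
    (subsingleton_setOf_lt_borelHeight_out_mul siegel_two hT g).finite
  have hΨ : ∀ z : ℂ, pseudoEisenstein (constantTermTail ν 𝓕 T (eisensteinSeriesU (flatSectionU φ z))) g =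
      ∑ q ∈ hfin.toFinset, Set.indicator {x : (quasiSplit (↥(maximalRealSubfield L)) L (IsCMField.complexConj L) 2).Adelic | T < borelHeight x} (borelConstantTerm ν 𝓕 (eisensteinSeriesU (flatSectionU φ z)))
        (((q.out : (quasiSplit (↥(maximalRealSubfield L)) L (IsCMField.complexConj L) 2).arithmeticSubgroup) : (quasiSplit (↥(maximalRealSubfield L)) L (IsCMField.complexConj L) 2).Adelic) * g) := by
    intro z
    rw [pseudoEisenstein_def]
    refine finsum_eq_sum_of_support_subset _ fun q hq => ?_
    rw [Set.Finite.coe_toFinset, Set.mem_setOf_eq]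
    by_contra hnot
    simp only [Function.mem_support, ne_eq] at hq
    exact hq (Set.indicator_of_notMem (show ((q.out : (quasiSplit (↥(maximalRealSubfield L)) L (IsCMField.complexConj L) 2).arithmeticSubgroup) : (quasiSplit (↥(maximalRealSubfield L)) L (IsCMField.complexConj L) 2).Adelic) * g ∉ {x : (quasiSplit (↥(maximalRealSubfield L)) L (IsCMField.complexConj L) 2).Adelic | T < borelHeight x} from hnot) _)
  have hfun : (fun z : ℂ => truncation ν 𝓕 T (eisensteinSeriesU (flatSectionU φ z)) g) = fun z : ℂ => eisensteinSeriesU (flatSectionU φ z) g -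
      ∑ q ∈ hfin.toFinset, Set.indicator {x : (quasiSplit (↥(maximalRealSubfield L)) L (IsCMField.complexConj L) 2).Adelic | T < borelHeight x} (borelConstantTerm ν 𝓕 (eisensteinSeriesU (flatSectionU φ z)))
        (((q.out : (quasiSplit (↥(maximalRealSubfield L)) L (IsCMField.complexConj L) 2).arithmeticSubgroup) : (quasiSplit (↥(maximalRealSubfield L)) L (IsCMField.complexConj L) 2).Adelic) * g) := by
    funext z
    rw [truncation_def, hΨ z]
  rw [hfun]
  refine (differentiableOn_eisensteinSeriesU_flatSectionU_cm_two L hφM g).sub (DifferentiableOn.fun_sum fun q _ => ?_)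
  by_cases hq : T < borelHeight (((q.out : (quasiSplit (↥(maximalRealSubfield L)) L (IsCMField.complexConj L) 2).arithmeticSubgroup) : (quasiSplit (↥(maximalRealSubfield L)) L (IsCMField.complexConj L) 2).Adelic) * g)
  · simp only [Set.indicator_of_mem (show _ ∈ {x : (quasiSplit (↥(maximalRealSubfield L)) L (IsCMField.complexConj L) 2).Adelic | T < borelHeight x} from hq)]
    exact differentiableOn_borelConstantTerm_eisensteinSeriesU_flatSectionU_cm_two L ν h𝓕m h𝓕c hφc hφM _
  · simp only [Set.indicator_of_notMem (show _ ∉ {x : (quasiSplit (↥(maximalRealSubfield L)) L (IsCMField.complexConj L) 2).Adelic | T < borelHeight x} from hq)]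
    exact differentiableOn_const _

end Pointwise

/-! ## §C The `L²(X)`-valued truncated spherical Eisenstein family is holomorphic on the tube `{Re z > 1}` -/

section L2Family

variable (L : Type) [Field L] [NumberField L] [IsCMField L]
-- the Borel structure of `U(J₂)(𝔸_{L⁺})`; `N(𝔸)` carries the induced (subtype) Borel structure, as in ★ `exists_bound_sub_borelConstantTerm_sphericalEisenstein_cm_two`
variable [MeasurableSpace (quasiSplit (↥(maximalRealSubfield L)) L (IsCMField.complexConj L) 2).Adelic] [BorelSpace (quasiSplit (↥(maximalRealSubfield L)) L (IsCMField.complexConj L) 2).Adelic]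

/-- **THE TRUNCATED SPHERICAL EISENSTEIN SERIES IS AN `L²(X)`-HOLOMORPHIC FAMILY ON `{Re z > 1}`.**  For `T ≥ 1`, `φ₀ ∈ ℂ`, a Haar measure `ν` on `N(𝔸)` with a relatively compact fundamental
domain `𝓕` for `N(L⁺)`, and any finite measure `μ` on the automorphic quotient `X` of `U(1,1)_{L∕L⁺}`: there is `F : ℂ → L²(X, μ)` with `F z = [Λ^T E(φ₀H^z)]` a.e. for `Re z > 1` and `F` complex
differentiable (as an `L²`-valued map) on `{Re z > 1}` — ★ `differentiableOn_of_weighted_bound` (`W = 1`) on a neighbourhood of each point, fed by §B (pointwise holomorphy), the locally uniform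
sup bound ★ `exists_nhds_norm_truncation_eisensteinSeriesU_flatSectionU_le_cm_two` with the UNCONDITIONAL decay ★ `exists_bound_sub_borelConstantTerm_sphericalEisenstein_cm_two` (a trace-zero
`δ ∈ L⁻ ∖ 0` and the archimedean order `m = [L⁺:ℚ] + 1` chosen inside), and ★ `memLp_quotFun_truncation_eisensteinSeriesU_flatSectionU_cm_two`. [cite: BernsteinLapid2019, §4 Claim 5]
[cite: MoeglinWaldspurger1995, IV.2.3, IV.3.12] [cite: Rudin1991, Thm. 3.31] -/
theorem exists_toLp_truncation_differentiableOn_cm_two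
    (ν : Measure (adelicUnipotent (↥(maximalRealSubfield L)) L (IsCMField.complexConj L) 2)) [ν.IsHaarMeasure]
    {𝓕 : Set (adelicUnipotent (↥(maximalRealSubfield L)) L (IsCMField.complexConj L) 2)}
    (h𝓕 : IsFundamentalDomain (rationalUnipotent (↥(maximalRealSubfield L)) L (IsCMField.complexConj L) 2) 𝓕 ν) (h𝓕c : IsCompact (closure 𝓕))
    {T : ℝ≥0} (hT : 1 ≤ T) (φ₀ : ℂ) (μ : Measure (quasiSplit (↥(maximalRealSubfield L)) L (IsCMField.complexConj L) 2).automorphicQuotient) [IsFiniteMeasure μ] :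
    ∃ F : ℂ → Lp ℂ 2 μ, DifferentiableOn ℂ F {z : ℂ | 1 < z.re} ∧
      ∀ z : ℂ, 1 < z.re → ((F z : Lp ℂ 2 μ) : (quasiSplit (↥(maximalRealSubfield L)) L (IsCMField.complexConj L) 2).automorphicQuotient → ℂ) =ᵐ[μ] (quasiSplit (↥(maximalRealSubfield L)) L (IsCMField.complexConj L) 2).quotFun (truncation ν 𝓕 T (eisensteinSeriesU (flatSectionU (fun _ : (quasiSplit (↥(maximalRealSubfield L)) L (IsCMField.complexConj L) 2).Adelic => φ₀) z))) := by
  classical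
  -- a trace-zero letter `δ ∈ L⁻ ∖ 0` (for the archimedean smoothness binder behind the decay)
  obtain ⟨δ, hδ, hcδ⟩ : ∃ δ : L, δ ≠ 0 ∧ IsCMField.complexConj L δ = -δ := by
    obtain ⟨x, hx⟩ : ∃ x : L, IsCMField.complexConj L x ≠ x := by
      by_contra h
      exact IsCMField.complexConj_ne_one (K := L) (AlgEquiv.ext fun x => not_not.1 fun hx => h ⟨x, hx⟩)
    exact ⟨x - IsCMField.complexConj L x, sub_ne_zero.2 (Ne.symm hx), by rw [map_sub, IsCMField.complexConj_apply_apply, neg_sub]⟩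
  have hm : (Module.finrank ℚ ↥(maximalRealSubfield L) : ℝ) < (Module.finrank ℚ ↥(maximalRealSubfield L) + 1 : ℕ) := by exact_mod_cast Nat.lt_succ_self _
  -- `L²` membership at each point of the tube
  have hmem : ∀ z : ℂ, 1 < z.re → MemLp ((quasiSplit (↥(maximalRealSubfield L)) L (IsCMField.complexConj L) 2).quotFun (truncation ν 𝓕 T (eisensteinSeriesU (flatSectionU (fun _ : (quasiSplit (↥(maximalRealSubfield L)) L (IsCMField.complexConj L) 2).Adelic => φ₀) z)))) 2 μ := by
    intro z hz
    obtain ⟨M₁, hM₁⟩ := exists_bound_sub_borelConstantTerm_sphericalEisenstein_cm_two L hcδ hδ ν h𝓕 h𝓕c hm hT φ₀ (isCompact_singleton (x := z))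
      (fun w hw => by rw [Set.mem_singleton_iff.1 hw]; exact hz) (R := ‖z‖) (fun w hw => by rw [Set.mem_singleton_iff.1 hw])
    exact memLp_quotFun_truncation_eisensteinSeriesU_flatSectionU_cm_two L ν h𝓕 hT hz continuous_const (M := ‖φ₀‖) (fun _ => le_rfl) (fun _ _ _ => rfl)
      (hM₁ z (Set.mem_singleton z)) μ 2
  -- the family
  refine ⟨fun z => if h : MemLp ((quasiSplit (↥(maximalRealSubfield L)) L (IsCMField.complexConj L) 2).quotFun (truncation ν 𝓕 T (eisensteinSeriesU (flatSectionU (fun _ : (quasiSplit (↥(maximalRealSubfield L)) L (IsCMField.complexConj L) 2).Adelic => φ₀) z)))) 2 μ then h.toLp _ else 0, ?_, fun z hz => ?_⟩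
  swap
  · dsimp only
    rw [dif_pos (hmem z hz)]
    exact MemLp.coeFn_toLp _
  intro z₀ hz₀
  have hz₀' : 1 < z₀.re := hz₀
  -- a compact neighbourhood `V ⊆ {Re > 1}` of `z₀` with ONE sup bound for `Λ^T E(φ₀H^z)`, `z ∈ V`
  obtain ⟨V, hV, hVc, hV1, hbd⟩ := exists_nhds_norm_truncation_eisensteinSeriesU_flatSectionU_le_cm_two L ν h𝓕 hT hz₀' continuous_const (M := ‖φ₀‖) (fun _ => le_rfl) (fun _ _ _ => rfl)
  obtain ⟨R, hR⟩ := hVc.exists_bound_of_continuousOn (f := fun w : ℂ => w) continuous_id.continuousOn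
  obtain ⟨M₁, hM₁⟩ := exists_bound_sub_borelConstantTerm_sphericalEisenstein_cm_two L hcδ hδ ν h𝓕 h𝓕c hm hT φ₀ hVc hV1 hR
  obtain ⟨M₀, hM₀⟩ := hbd hM₁
  have h0V : z₀ ∈ interior V := mem_interior_iff_mem_nhds.2 hV
  have hIV : interior V ⊆ {z : ℂ | 1 < z.re} := fun z hz => hV1 z (interior_subset hz)
  have hdiffV : DifferentiableOn ℂ (fun z => if h : MemLp ((quasiSplit (↥(maximalRealSubfield L)) L (IsCMField.complexConj L) 2).quotFun (truncation ν 𝓕 T (eisensteinSeriesU (flatSectionU (fun _ : (quasiSplit (↥(maximalRealSubfield L)) L (IsCMField.complexConj L) 2).Adelic => φ₀) z)))) 2 μ then h.toLp _ else 0) (interior V) := by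
    refine differentiableOn_of_weighted_bound (μ := μ) (f := fun z => (quasiSplit (↥(maximalRealSubfield L)) L (IsCMField.complexConj L) 2).quotFun (truncation ν 𝓕 T (eisensteinSeriesU (flatSectionU (fun _ : (quasiSplit (↥(maximalRealSubfield L)) L (IsCMField.complexConj L) 2).Adelic => φ₀) z)))) isOpen_interior (fun x => ?_) (fun s hs => (hmem s (hIV hs)).1)
      (W := fun _ => (1 : ℝ)) (memLp_const 1) (C := max (max M₀ M₁) 0) (le_max_right _ _) (fun s hs x => ?_) (fun s hs => ?_)
    · exact (differentiableOn_truncation_eisensteinSeriesU_flatSectionU_apply_cm_two L ν h𝓕.nullMeasurableSet h𝓕c hT continuous_const (M := ‖φ₀‖) (fun _ => le_rfl) _).mono hIV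
    · rw [mul_one]
      exact (AdelicGroupData.norm_quotFun_le (hM₀ s (interior_subset hs)) x).trans (le_max_left _ _)
    · show (((if h : MemLp ((quasiSplit (↥(maximalRealSubfield L)) L (IsCMField.complexConj L) 2).quotFun (truncation ν 𝓕 T (eisensteinSeriesU (flatSectionU (fun _ : (quasiSplit (↥(maximalRealSubfield L)) L (IsCMField.complexConj L) 2).Adelic => φ₀) s)))) 2 μ then h.toLp _ else 0 : Lp ℂ 2 μ)) : (quasiSplit (↥(maximalRealSubfield L)) L (IsCMField.complexConj L) 2).automorphicQuotient → ℂ) =ᵐ[μ] (quasiSplit (↥(maximalRealSubfield L)) L (IsCMField.complexConj L) 2).quotFun (truncation ν 𝓕 T (eisensteinSeriesU (flatSectionU (fun _ : (quasiSplit (↥(maximalRealSubfield L)) L (IsCMField.complexConj L) 2).Adelic => φ₀) s)))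
      rw [dif_pos (hmem s (hIV hs))]
      exact MemLp.coeFn_toLp _
  exact ((hdiffV z₀ h0V).differentiableAt (isOpen_interior.mem_nhds h0V)).differentiableWithinAt

end L2Family

/-! ## §D HEAD: the pairing on the tube — `hΦ₁`, `hΦ₂`, `hQ` on `{Re > 1}`, and the inner product as the Maass–Selberg left side -/

section Tube

variable (L : Type) [Field L] [NumberField L] [IsCMField L]
-- the Borel structure of `U(J₂)(𝔸_{L⁺})`; `N(𝔸)` carries the induced (subtype) Borel structure, as in ★ `exists_bound_sub_borelConstantTerm_sphericalEisenstein_cm_two`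
variable [MeasurableSpace (quasiSplit (↥(maximalRealSubfield L)) L (IsCMField.complexConj L) 2).Adelic] [BorelSpace (quasiSplit (↥(maximalRealSubfield L)) L (IsCMField.complexConj L) 2).Adelic]

/-- **HEAD — THE PAIRING SUPPLIER ON THE TUBE.**  For `T ≥ 1`, `φ₀`, `ν`, `𝓕` as in §C and any finite measure `μ` on the automorphic quotient `X` of `U(1,1)_{L∕L⁺}` there is an `L²(X,μ)`-valued
family `F` with `F z = [Λ^T E(φ₀H^z)]` a.e. (`Re z > 1`) such that the pairing `Φ z z′ := ⟪F z′, F z⟫` satisfies, on `U = {Re > 1}`: (`hΦ₁`) `z ↦ Φ z z′` holomorphic on `U` (`z′ ∈ U`);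
(`hΦ₂`) `w ↦ Φ z (conj w)` holomorphic on `{Re w > 1} = conj⁻¹U` (`z ∈ U`); (`hQ`) `Φ z z = ‖F z‖² ≥ 0`; and (`hrel`, raw form) `Φ z z′ = ∫_X Λ^TE(z)·conj Λ^TE(z′) dμ` — the LEFT SIDE of ★
(R6k)₂ `maassSelberg_flatSectionU_cm_two_final_spherical` VERBATIM, so that ★ (R6k)₂ (with its survivor `hdec′` paid by ★ `exists_bound_sub_borelConstantTerm_sphericalEisenstein_cm_two`) turns
it into the four-term `R(z,z′;c)` on the sub-tube `1 < Re z′ < Re z`.  These are the four binders of ★ `poleControl_continued_cm_two_of_pairing` RESTRICTED TO THE TUBE; the continued half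
(`½ < Re ≤ 1`) takes the same §A with the continued family. [cite: MoeglinWaldspurger1995, IV.2.3, IV.3.12] [cite: Arthur1980TraceFormulaII, §4] [cite: BernsteinLapid2019, §4 Claim 5] -/
theorem pairing_tube_cm_two
    (ν : Measure (adelicUnipotent (↥(maximalRealSubfield L)) L (IsCMField.complexConj L) 2)) [ν.IsHaarMeasure]
    {𝓕 : Set (adelicUnipotent (↥(maximalRealSubfield L)) L (IsCMField.complexConj L) 2)}
    (h𝓕 : IsFundamentalDomain (rationalUnipotent (↥(maximalRealSubfield L)) L (IsCMField.complexConj L) 2) 𝓕 ν) (h𝓕c : IsCompact (closure 𝓕))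
    {T : ℝ≥0} (hT : 1 ≤ T) (φ₀ : ℂ) (μ : Measure (quasiSplit (↥(maximalRealSubfield L)) L (IsCMField.complexConj L) 2).automorphicQuotient) [IsFiniteMeasure μ] :
    ∃ F : ℂ → Lp ℂ 2 μ,
      (∀ z : ℂ, 1 < z.re → ((F z : Lp ℂ 2 μ) : (quasiSplit (↥(maximalRealSubfield L)) L (IsCMField.complexConj L) 2).automorphicQuotient → ℂ) =ᵐ[μ] (quasiSplit (↥(maximalRealSubfield L)) L (IsCMField.complexConj L) 2).quotFun (truncation ν 𝓕 T (eisensteinSeriesU (flatSectionU (fun _ : (quasiSplit (↥(maximalRealSubfield L)) L (IsCMField.complexConj L) 2).Adelic => φ₀) z)))) ∧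
      (∀ z' ∈ {z : ℂ | 1 < z.re}, DifferentiableOn ℂ (fun z : ℂ => ⟪F z', F z⟫_ℂ) {z : ℂ | 1 < z.re}) ∧
      (∀ z ∈ {z : ℂ | 1 < z.re}, DifferentiableOn ℂ (fun w : ℂ => ⟪F (conj w), F z⟫_ℂ) {w : ℂ | 1 < w.re}) ∧
      (∀ z ∈ {z : ℂ | 1 < z.re}, 0 ≤ ‖F z‖ ^ 2 ∧ ⟪F z, F z⟫_ℂ = (((‖F z‖ ^ 2 : ℝ)) : ℂ)) ∧
      (∀ z z' : ℂ, 1 < z.re → 1 < z'.re →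
        ⟪F z', F z⟫_ℂ = ∫ x, (quasiSplit (↥(maximalRealSubfield L)) L (IsCMField.complexConj L) 2).quotFun (truncation ν 𝓕 T (eisensteinSeriesU (flatSectionU (fun _ : (quasiSplit (↥(maximalRealSubfield L)) L (IsCMField.complexConj L) 2).Adelic => φ₀) z))) x * conj ((quasiSplit (↥(maximalRealSubfield L)) L (IsCMField.complexConj L) 2).quotFun (truncation ν 𝓕 T (eisensteinSeriesU (flatSectionU (fun _ : (quasiSplit (↥(maximalRealSubfield L)) L (IsCMField.complexConj L) 2).Adelic => φ₀) z'))) x) ∂μ) := by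
  obtain ⟨F, hFd, hF⟩ := exists_toLp_truncation_differentiableOn_cm_two L ν h𝓕 h𝓕c hT φ₀ μ
  obtain ⟨h₁, h₂, h₃⟩ := pairing_of_differentiableOn (isOpen_lt continuous_const Complex.continuous_re) hFd
  have hconj : {w : ℂ | conj w ∈ {z : ℂ | 1 < z.re}} = {w : ℂ | 1 < w.re} := by
    ext w; simp only [Set.mem_setOf_eq, Complex.conj_re]
  refine ⟨F, hF, h₁, fun z hz => hconj ▸ h₂ z hz, h₃, fun z z' hz hz' => ?_⟩
  rw [MeasureTheory.L2.inner_def]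
  refine integral_congr_ae ?_
  filter_upwards [hF z hz, hF z' hz'] with x hx hx'
  rw [hx, hx', RCLike.inner_apply, mul_comm]

end Tube

end Summit.HodgeConjecture.HodgeConjecture.Cruxes.H413.K2E1MaassSelbergPairingCMTwo

end
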